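/-
# CoverCount — how many DISTINCT support cells a class cover needs (kernel form of SHELL3-FLAYER §4 (E7)–(E8), volume part)

`Summits/HodgeConjecture/HodgeConjecture/Cruxes/BlochSeedDiscOne/CoverCount.lean` — plan-lens-HodgeAV-anomaly **g16**
(planner, lens «anomaly», director-hodge req-36 ∕ R19.683 (S3-5) ∕ R19.688 (iii); crux workfile under `stmt-HodgeConjecture-18881`,
NOT a proposal). A LEAF module on negation g21's `BoxIdentity.lean` (v2): nothing there is restated.

WHAT IS PROVED (sorry-free; every height `hgt`, every ring, clause 1 `A1e` + alphabet only — ROOM-FREE: the room enters only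
through the displayed hypothesis «every hub-free N-support cell has at most `j` off-axis letters»).

* §1 `slab_pos_iff`: for a non-hub letter `ℓ` on the alphabet, `slab_t(ℓ) > 0` iff `t` lies in the cyclic phase interval
  `{pstart ℓ, …, pstart ℓ + plen ℓ − 1}` of length `plen ℓ = 2` (axis letter) or `3` (off-axis letter); a hub letter kills every box
  (`psi_eq_zero_of_hub`). `psi_pos_iff`: a cell MEETS the box `x` (`ψ_x(c) > 0`) iff every letter does.
* §2 COUNTING (`decide`): the boxes of ONE class met by a hub-free cell with `n` off-axis letters number at most
  `cap n = 6, 7, 10, 14, 21` (`n = 0, 1, 2, 3, 4`) — `met_card_le`. (Translation to start phase `0`: `ivl_card_shift`; the table: `ivl0_card_le`.)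
* §3 DESIGN LEVEL: in BRANCH A′ of class `k` (`2Σ − Re(i^k μ) > 0`, negation's `classA_meets`: every class-`k` box meets the N support)
  the hub-free N-support cells meeting class `k` satisfy `64 ≤ Σ_c cap(offaxis c)` (`classA_cover_volume`); hence
  **`classA_ten_cells`**: if every hub-free N-support cell has ≤ 1 off-axis letter (the fine ring-3 room: N types `u⁴, Auuu, Buuu`)
  then at least **10** distinct N-support cells meet class `k`; `classA_eleven_cells`: axis-only N cells ⇒ ≥ 11;
  **`classB_seven_cells`**: in BRANCH B′ (class `k+2` boxes meet the P support, `classB_meets`), if every hub-free P-support cell has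
  ≤ 2 off-axis letters (fine room: all ten hub-free P types) then ≥ 7 distinct P-support cells meet class `k+2`.

v1.1 (docstring only): the fine-room P-type list in `classB_seven_cells`'s docstring corrected; no statement changed.

These are the VOLUME bounds of the memo (pd one class ≥ 10 — attained, so exact; squares ≥ 7); the sharper packing digits
(axis-only ≥ 13, two classes ≥ 10…12) are NOT claimed here.

HC ∕ HC_AV ∕ HC_CM ∕ H2 ∕ `stmt-HodgeConjecture-18881` ∕ `FloorFree 6 199 8` are NOT proved here or anywhere;
`DepthBoundA4.Nonex 14 199 8` is REFUTED as typed. Facts about letter designs (READING 1 bookkeeping).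
-/
import Summits.HodgeConjecture.HodgeConjecture.Cruxes.BlochSeedDiscOne.BoxIdentity

set_option linter.dupNamespace false
set_option linter.style.longLine false
set_option linter.unusedVariables false
set_option linter.style.nativeDecide false
set_option linter.style.multiGoal false
set_option linter.style.cdot false

namespace Summit.HodgeConjecture.HodgeConjecture.Cruxes.BlochSeedDiscOne.CoverCount

open Summit.HodgeConjecture.HodgeConjecture.Cruxes.BlochSeedDiscOne.DepthBoundA4
open Summit.HodgeConjecture.HodgeConjecture.Cruxes.BlochSeedDiscOne.BoxIdentity

/-! ### §1 Which boxes a letter ∕ a cell meets -/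

/-- Off-axis letter: `x ≠ 0` and `y ≠ 0` (Boolean, so that counting off-axis slots needs no instance). -/
def offB (ℓ : Letter) : Bool := decide (ℓ.x ≠ 0 ∧ ℓ.y ≠ 0)

/-- Start of the cyclic interval of phases `t` with `slab_t(ℓ) > 0` (non-hub letters). -/
def pstart (ℓ : Letter) : Fin 4 :=
  if 0 < ℓ.x ∧ 0 ≤ ℓ.y then 1 else if ℓ.x ≤ 0 ∧ 0 < ℓ.y then 2 else if ℓ.x < 0 ∧ ℓ.y ≤ 0 then 3 else 0

/-- Length of that interval: `2` for an axis letter, `3` for an off-axis letter. -/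
def plen (ℓ : Letter) : ℕ := if ℓ.x ≠ 0 ∧ ℓ.y ≠ 0 then 3 else 2

/-- **Positive-slab phases.** For a non-hub letter on the height-`hgt` alphabet, `slab_t(ℓ) > 0 ↔ (t − pstart ℓ) mod 4 < plen ℓ`. -/
theorem slab_pos_iff (hgt : ℤ) (t : Fin 4) (ℓ : Letter) (hℓ : ℓ.OnAlphabet hgt) (hnh : ¬(ℓ.x = 0 ∧ ℓ.y = 0)) :
    0 < slab hgt t ℓ ↔ (t - pstart ℓ).val < plen ℓ := by
  obtain ⟨hh, ha⟩ := hℓ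
  unfold Letter.height at hh
  rcases lt_trichotomy ℓ.x 0 with hx | hx | hx <;> rcases lt_trichotomy ℓ.y 0 with hy | hy | hy
  -- x < 0, y < 0 : off-axis, start 3
  · have hax : |ℓ.x| = -ℓ.x := abs_of_neg hx
    have hay : |ℓ.y| = -ℓ.y := abs_of_neg hy
    have hp : pstart ℓ = 3 := by unfold pstart; split_ifs <;> first | rfl | omega
    have hl : plen ℓ = 3 := by unfold plen; split_ifs <;> first | rfl | omega
    rw [hp, hl]; fin_cases t <;> simp +decide [slab, spro] <;> omega
  -- x < 0, y = 0 : axis, start 3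
  · have hax : |ℓ.x| = -ℓ.x := abs_of_neg hx
    have hp : pstart ℓ = 3 := by unfold pstart; split_ifs <;> first | rfl | omega
    have hl : plen ℓ = 2 := by unfold plen; split_ifs <;> first | rfl | omega
    have hay : |ℓ.y| = 0 := by rw [hy, abs_zero]
    rw [hp, hl]; fin_cases t <;> simp +decide [slab, spro] <;> omega
  -- x < 0, y > 0 : off-axis, start 2
  · have hax : |ℓ.x| = -ℓ.x := abs_of_neg hx
    have hay : |ℓ.y| = ℓ.y := abs_of_pos hy
    have hp : pstart ℓ = 2 := by unfold pstart; split_ifs <;> first | rfl | omega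
    have hl : plen ℓ = 3 := by unfold plen; split_ifs <;> first | rfl | omega
    rw [hp, hl]; fin_cases t <;> simp +decide [slab, spro] <;> omega
  -- x = 0, y < 0 : axis, start 0
  · have hay : |ℓ.y| = -ℓ.y := abs_of_neg hy
    have hp : pstart ℓ = 0 := by unfold pstart; split_ifs <;> first | rfl | omega
    have hl : plen ℓ = 2 := by unfold plen; split_ifs <;> first | rfl | omega
    have hax : |ℓ.x| = 0 := by rw [hx, abs_zero]
    rw [hp, hl]; fin_cases t <;> simp +decide [slab, spro] <;> omega
  -- x = 0, y = 0 : hub, excluded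
  · exact absurd ⟨hx, hy⟩ hnh
  -- x = 0, y > 0 : axis, start 2
  · have hay : |ℓ.y| = ℓ.y := abs_of_pos hy
    have hp : pstart ℓ = 2 := by unfold pstart; split_ifs <;> first | rfl | omega
    have hl : plen ℓ = 2 := by unfold plen; split_ifs <;> first | rfl | omega
    have hax : |ℓ.x| = 0 := by rw [hx, abs_zero]
    rw [hp, hl]; fin_cases t <;> simp +decide [slab, spro] <;> omega
  -- x > 0, y < 0 : off-axis, start 0
  · have hax : |ℓ.x| = ℓ.x := abs_of_pos hx
    have hay : |ℓ.y| = -ℓ.y := abs_of_neg hy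
    have hp : pstart ℓ = 0 := by unfold pstart; split_ifs <;> first | rfl | omega
    have hl : plen ℓ = 3 := by unfold plen; split_ifs <;> first | rfl | omega
    rw [hp, hl]; fin_cases t <;> simp +decide [slab, spro] <;> omega
  -- x > 0, y = 0 : axis, start 1
  · have hax : |ℓ.x| = ℓ.x := abs_of_pos hx
    have hp : pstart ℓ = 1 := by unfold pstart; split_ifs <;> first | rfl | omega
    have hl : plen ℓ = 2 := by unfold plen; split_ifs <;> first | rfl | omega
    have hay : |ℓ.y| = 0 := by rw [hy, abs_zero]
    rw [hp, hl]; fin_cases t <;> simp +decide [slab, spro] <;> omega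
  -- x > 0, y > 0 : off-axis, start 1
  · have hax : |ℓ.x| = ℓ.x := abs_of_pos hx
    have hay : |ℓ.y| = ℓ.y := abs_of_pos hy
    have hp : pstart ℓ = 1 := by unfold pstart; split_ifs <;> first | rfl | omega
    have hl : plen ℓ = 3 := by unfold plen; split_ifs <;> first | rfl | omega
    rw [hp, hl]; fin_cases t <;> simp +decide [slab, spro] <;> omega

/-- A hub letter (`x = y = 0`, hence `a = hgt` on the alphabet) has every slab `= 0` … -/
theorem slab_eq_zero_of_hub (hgt : ℤ) (t : Fin 4) (ℓ : Letter) (hℓ : ℓ.OnAlphabet hgt) (hh : ℓ.x = 0 ∧ ℓ.y = 0) :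
    slab hgt t ℓ = 0 := by
  obtain ⟨hgtℓ, -⟩ := hℓ
  unfold Letter.height at hgtℓ
  fin_cases t <;> simp [slab, spro, hh.1, hh.2] <;> simp [hh.1, hh.2] at hgtℓ <;> omega

/-- … so a cell with a hub letter meets no box. -/
theorem psi_eq_zero_of_hub (hgt : ℤ) (x : Fin 4 → Fin 4) (c : Cell) (hc : ∀ f : Fin 4, (c f).OnAlphabet hgt)
    (f : Fin 4) (hh : (c f).x = 0 ∧ (c f).y = 0) : psi hgt x c = 0 :=
  Finset.prod_eq_zero (Finset.mem_univ f) (slab_eq_zero_of_hub hgt (x f) (c f) (hc f) hh)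

/-- **A cell meets a box iff every letter does:** `ψ_x(c) > 0 ↔ ∀ f, slab_{x_f}(c_f) > 0` (on the alphabet). -/
theorem psi_pos_iff (hgt : ℤ) (x : Fin 4 → Fin 4) (c : Cell) (hc : ∀ f : Fin 4, (c f).OnAlphabet hgt) :
    0 < psi hgt x c ↔ ∀ f : Fin 4, 0 < slab hgt (x f) (c f) := by
  constructor
  · intro h f
    rcases (slab_nonneg hgt (x f) (c f) (hc f)).lt_or_eq with hlt | heq
    · exact hlt
    · exfalso
      have h0 : psi hgt x c = 0 := Finset.prod_eq_zero (Finset.mem_univ f) heq.symm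
      omega
  · intro h
    exact Finset.prod_pos fun f _ => h f

/-! ### §2 Counting boxes of one class in a product of cyclic intervals -/

/-- Boxes of class `k` whose phases lie in the cyclic intervals `[s_f, s_f + l_f)`. -/
def ivl (s : Fin 4 → Fin 4) (l : Fin 4 → ℕ) (k : Fin 4) : Finset (Fin 4 → Fin 4) :=
  Finset.univ.filter fun x => wt x = k ∧ ∀ f : Fin 4, (x f - s f).val < l f

theorem wt_sub (x s : Fin 4 → Fin 4) : wt (x - s) = wt x - wt s := by
  simp only [wt, Pi.sub_apply]; abel

theorem wt_add (x s : Fin 4 → Fin 4) : wt (x + s) = wt x + wt s := by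
  simp only [wt, Pi.add_apply]; abel

/-- Translation to start phase `0` (a bijection `x ↦ x − s`, shifting the class by `wt s`). -/
theorem ivl_card_shift (s : Fin 4 → Fin 4) (l : Fin 4 → ℕ) (k : Fin 4) :
    (ivl s l k).card = (ivl 0 l (k - wt s)).card := by
  apply Finset.card_bij' (fun x _ => x - s) (fun x _ => x + s)
  · intro x hx
    simp only [ivl, Finset.mem_filter, Finset.mem_univ, true_and] at hx ⊢
    refine ⟨by rw [wt_sub, hx.1], fun f => ?_⟩
    simpa using hx.2 f
  · intro x hx
    simp only [ivl, Finset.mem_filter, Finset.mem_univ, true_and] at hx ⊢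
    refine ⟨by rw [wt_add, hx.1, sub_add_cancel], fun f => ?_⟩
    simpa using hx.2 f
  · intro x hx; simp
  · intro x hx; simp

/-- Interval lengths from an off-axis mask: `3` where off-axis, `2` where axis. -/
def lenOf (b : Fin 4 → Bool) : Fin 4 → ℕ := fun f => if b f then 3 else 2

/-- Number of off-axis slots of a mask. -/
def nOff (b : Fin 4 → Bool) : ℕ := (Finset.univ.filter fun f : Fin 4 => b f = true).card

/-- The per-class box CAP as a function of the number of off-axis letters: `6, 7, 10, 14, 21`. -/
def cap (n : ℕ) : ℕ := if n = 0 then 6 else if n = 1 then 7 else if n = 2 then 10 else if n = 3 then 14 else 21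

/-- **THE TABLE** (finite check): a product of intervals of lengths `2 ∕ 3` with `n` long ones contains at most `cap n` boxes of each class. -/
theorem ivl0_card_le : ∀ b : Fin 4 → Bool, ∀ k : Fin 4, (ivl 0 (lenOf b) k).card ≤ cap (nOff b) := by
  decide

/-- The number of class-`k` boxes is `64`. -/
theorem card_class (k : Fin 4) : (Finset.univ.filter fun x : Fin 4 → Fin 4 => wt x = k).card = 64 := by
  revert k; decide

/-! ### §3 Cells and designs -/

/-- The class-`k` boxes MET by the cell `c`. -/
def met (hgt : ℤ) (c : Cell) (k : Fin 4) : Finset (Fin 4 → Fin 4) :=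
  Finset.univ.filter fun x => wt x = k ∧ 0 < psi hgt x c

/-- Number of off-axis letters of a cell. -/
def offCount (c : Cell) : ℕ := nOff fun f => offB (c f)

theorem met_subset_ivl (hgt : ℤ) (c : Cell) (k : Fin 4) (hc : ∀ f : Fin 4, (c f).OnAlphabet hgt)
    (hnh : ∀ f : Fin 4, ¬((c f).x = 0 ∧ (c f).y = 0)) :
    met hgt c k ⊆ ivl (fun f => pstart (c f)) (lenOf fun f => offB (c f)) k := by
  intro x hx
  simp only [met, ivl, Finset.mem_filter, Finset.mem_univ, true_and] at hx ⊢
  refine ⟨hx.1, fun f => ?_⟩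
  have h := ((psi_pos_iff hgt x c hc).1 hx.2) f
  have h' := (slab_pos_iff hgt (x f) (c f) (hc f) (hnh f)).1 h
  have hpl : lenOf (fun f => offB (c f)) f = plen (c f) := by
    simp only [lenOf, offB, plen, decide_eq_true_eq]
  rw [hpl]; exact h'

/-- **Per-cell cap:** a hub-free cell on the alphabet meets at most `cap (offCount c)` boxes of each class (`6 ∕ 7 ∕ 10 ∕ 14 ∕ 21`). -/
theorem met_card_le (hgt : ℤ) (c : Cell) (k : Fin 4) (hc : ∀ f : Fin 4, (c f).OnAlphabet hgt)
    (hnh : ∀ f : Fin 4, ¬((c f).x = 0 ∧ (c f).y = 0)) : (met hgt c k).card ≤ cap (offCount c) := by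
  calc (met hgt c k).card ≤ (ivl (fun f => pstart (c f)) (lenOf fun f => offB (c f)) k).card :=
        Finset.card_le_card (met_subset_ivl hgt c k hc hnh)
    _ = (ivl 0 (lenOf fun f => offB (c f)) (k - wt fun f => pstart (c f))).card := ivl_card_shift _ _ _
    _ ≤ cap (nOff fun f => offB (c f)) := ivl0_card_le _ _
    _ = cap (offCount c) := rfl

/-- A cell with a hub letter meets nothing. -/
theorem met_eq_empty_of_hub (hgt : ℤ) (c : Cell) (k : Fin 4) (hc : ∀ f : Fin 4, (c f).OnAlphabet hgt)
    (f : Fin 4) (hh : (c f).x = 0 ∧ (c f).y = 0) : met hgt c k = ∅ := by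
  ext x
  simp only [met, Finset.mem_filter, Finset.mem_univ, true_and, Finset.notMem_empty, iff_false, not_and, not_lt]
  intro _
  rw [psi_eq_zero_of_hub hgt x c hc f hh]

/-- The N-support cells MEETING class `k` (as a finset of distinct cells). -/
noncomputable def meetN (hgt : ℤ) (D : Design) (k : Fin 4) : Finset Cell :=
  D.suppN.toFinset.filter fun c => (met hgt c k).Nonempty

/-- The P-support cells meeting class `k`. -/
noncomputable def meetP (hgt : ℤ) (D : Design) (k : Fin 4) : Finset Cell :=
  D.suppP.toFinset.filter fun c => (met hgt c k).Nonempty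

/-- **COVER VOLUME LAW (N side).** In BRANCH A′ of class `k` the cells of `meetN` carry all `64` class-`k` boxes:
`64 ≤ Σ_{c ∈ meetN} #met(c, k)`. -/
theorem classA_cover_volume (hgt : ℤ) (D : Design) (hO : D.OnAlphabet hgt) (hA : A1e D) (k : Fin 4)
    (hpos : 0 < 2 * Sigma hgt D - (ipow k * D.mu).re) :
    64 ≤ ∑ c ∈ meetN hgt D k, (met hgt c k).card := by
  have hsub : (Finset.univ.filter fun x : Fin 4 → Fin 4 => wt x = k) ⊆ (meetN hgt D k).biUnion fun c => met hgt c k := by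
    intro x hx
    simp only [Finset.mem_filter, Finset.mem_univ, true_and] at hx
    obtain ⟨c, hc, hpsi⟩ := classA_meets hgt D hO hA k hpos x hx
    simp only [Finset.mem_biUnion, meetN, Finset.mem_filter, List.mem_toFinset]
    exact ⟨c, ⟨hc, ⟨x, by simp [met, hx, hpsi]⟩⟩, by simp [met, hx, hpsi]⟩
  calc 64 = (Finset.univ.filter fun x : Fin 4 → Fin 4 => wt x = k).card := (card_class k).symm
    _ ≤ ((meetN hgt D k).biUnion fun c => met hgt c k).card := Finset.card_le_card hsub
    _ ≤ ∑ c ∈ meetN hgt D k, (met hgt c k).card := Finset.card_biUnion_le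

/-- **COVER VOLUME LAW (P side).** In BRANCH B′ (`Re(i^k μ) ≤ −16`, `2Σ − Re(i^k μ) ≤ 0`) the cells of `meetP` carry all `64` boxes of class `k + 2`. -/
theorem classB_cover_volume (hgt : ℤ) (D : Design) (hO : D.OnAlphabet hgt) (hA : A1e D) (k : Fin 4)
    (hk : 16 ≤ -(ipow k * D.mu).re) (hnonpos : 2 * Sigma hgt D - (ipow k * D.mu).re ≤ 0) :
    64 ≤ ∑ c ∈ meetP hgt D (k + 2), (met hgt c (k + 2)).card := by
  have hsub : (Finset.univ.filter fun x : Fin 4 → Fin 4 => wt x = k + 2) ⊆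
      (meetP hgt D (k + 2)).biUnion fun c => met hgt c (k + 2) := by
    intro x hx
    simp only [Finset.mem_filter, Finset.mem_univ, true_and] at hx
    obtain ⟨c, hc, hpsi⟩ := classB_meets hgt D hO hA k hk hnonpos x hx
    simp only [Finset.mem_biUnion, meetP, Finset.mem_filter, List.mem_toFinset]
    exact ⟨c, ⟨hc, ⟨x, by simp [met, hx, hpsi]⟩⟩, by simp [met, hx, hpsi]⟩
  calc 64 = (Finset.univ.filter fun x : Fin 4 → Fin 4 => wt x = k + 2).card := (card_class (k + 2)).symm
    _ ≤ ((meetP hgt D (k + 2)).biUnion fun c => met hgt c (k + 2)).card := Finset.card_le_card hsub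
    _ ≤ ∑ c ∈ meetP hgt D (k + 2), (met hgt c (k + 2)).card := Finset.card_biUnion_le

/-- A cell of `meetN` ∕ `meetP` is hub-free (it meets a box). -/
theorem hubfree_of_met_nonempty (hgt : ℤ) (c : Cell) (k : Fin 4) (hc : ∀ f : Fin 4, (c f).OnAlphabet hgt)
    (hne : (met hgt c k).Nonempty) : ∀ f : Fin 4, ¬((c f).x = 0 ∧ (c f).y = 0) := by
  intro f hh
  rw [met_eq_empty_of_hub hgt c k hc f hh] at hne
  exact Finset.not_nonempty_empty hne

/-- **TEN DISTINCT N CELLS.** Branch A′ of class `k` + «every hub-free N-support cell has at most one off-axis letter»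
(the fine ring-3 room: charged N types `u⁴, Auuu, Buuu`) ⇒ at least `10` distinct N-support cells meet class `k` (`64 ≤ 7·#cells`). -/
theorem classA_ten_cells (hgt : ℤ) (D : Design) (hO : D.OnAlphabet hgt) (hA : A1e D) (k : Fin 4)
    (hpos : 0 < 2 * Sigma hgt D - (ipow k * D.mu).re)
    (hroom : ∀ c ∈ D.suppN, (∀ f : Fin 4, ¬((c f).x = 0 ∧ (c f).y = 0)) → offCount c ≤ 1) :
    10 ≤ (meetN hgt D k).card := by
  have hvol := classA_cover_volume hgt D hO hA k hpos
  have hle : ∑ c ∈ meetN hgt D k, (met hgt c k).card ≤ ∑ c ∈ meetN hgt D k, 7 := by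
    apply Finset.sum_le_sum
    intro c hc
    simp only [meetN, Finset.mem_filter, List.mem_toFinset] at hc
    have hcO : ∀ f : Fin 4, (c f).OnAlphabet hgt := fun f => hO c (List.mem_append_left _ hc.1) f
    have hnh := hubfree_of_met_nonempty hgt c k hcO hc.2
    have h1 := met_card_le hgt c k hcO hnh
    have h2 : offCount c ≤ 1 := hroom c hc.1 hnh
    have h3 : cap (offCount c) ≤ 7 := by
      unfold cap; split_ifs <;> omega
    omega
  rw [Finset.sum_const, smul_eq_mul] at hle
  omega

/-- **ELEVEN for axis-only N cells** (`64 ≤ 6·#cells`; coarse room `{H,u,A,C}`: N types `u⁴, Auuu`). -/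
theorem classA_eleven_cells (hgt : ℤ) (D : Design) (hO : D.OnAlphabet hgt) (hA : A1e D) (k : Fin 4)
    (hpos : 0 < 2 * Sigma hgt D - (ipow k * D.mu).re)
    (hroom : ∀ c ∈ D.suppN, (∀ f : Fin 4, ¬((c f).x = 0 ∧ (c f).y = 0)) → offCount c = 0) :
    11 ≤ (meetN hgt D k).card := by
  have hvol := classA_cover_volume hgt D hO hA k hpos
  have hle : ∑ c ∈ meetN hgt D k, (met hgt c k).card ≤ ∑ c ∈ meetN hgt D k, 6 := by
    apply Finset.sum_le_sum
    intro c hc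
    simp only [meetN, Finset.mem_filter, List.mem_toFinset] at hc
    have hcO : ∀ f : Fin 4, (c f).OnAlphabet hgt := fun f => hO c (List.mem_append_left _ hc.1) f
    have hnh := hubfree_of_met_nonempty hgt c k hcO hc.2
    have h1 := met_card_le hgt c k hcO hnh
    have h2 : offCount c = 0 := hroom c hc.1 hnh
    have h3 : cap (offCount c) ≤ 6 := by
      unfold cap; split_ifs <;> omega
    omega
  rw [Finset.sum_const, smul_eq_mul] at hle
  omega

/-- **SEVEN DISTINCT P CELLS.** Branch B′ + «every hub-free P-support cell has at most two off-axis letters»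
(the fine ring-3 room: its ten hub-free P types `u⁴, Auuu, Buuu, Cuuu, Duuu, AAuu, ABuu, BBuu, AAAu, AAAA` have ≤ 2 off-axis letters, `BBuu` being the only one with two) ⇒ at least `7` distinct P-support cells meet class `k + 2`. -/
theorem classB_seven_cells (hgt : ℤ) (D : Design) (hO : D.OnAlphabet hgt) (hA : A1e D) (k : Fin 4)
    (hk : 16 ≤ -(ipow k * D.mu).re) (hnonpos : 2 * Sigma hgt D - (ipow k * D.mu).re ≤ 0)
    (hroom : ∀ c ∈ D.suppP, (∀ f : Fin 4, ¬((c f).x = 0 ∧ (c f).y = 0)) → offCount c ≤ 2) :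
    7 ≤ (meetP hgt D (k + 2)).card := by
  have hvol := classB_cover_volume hgt D hO hA k hk hnonpos
  have hle : ∑ c ∈ meetP hgt D (k + 2), (met hgt c (k + 2)).card ≤ ∑ c ∈ meetP hgt D (k + 2), 10 := by
    apply Finset.sum_le_sum
    intro c hc
    simp only [meetP, Finset.mem_filter, List.mem_toFinset] at hc
    have hcO : ∀ f : Fin 4, (c f).OnAlphabet hgt := fun f => hO c (List.mem_append_right _ hc.1) f
    have hnh := hubfree_of_met_nonempty hgt c (k + 2) hcO hc.2
    have h1 := met_card_le hgt c (k + 2) hcO hnh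
    have h2 : offCount c ≤ 2 := hroom c hc.1 hnh
    have h3 : cap (offCount c) ≤ 10 := by
      unfold cap; split_ifs <;> omega
    omega
  rw [Finset.sum_const, smul_eq_mul] at hle
  omega

/-- Sanity (fine room, height 14): `u = (13;1,0)` axis, `B = (12;1,1)` off-axis; the cell `Buuu` has `offCount = 1`, `AuuC` has `0`. -/
example : offB ⟨13, 1, 0⟩ = false ∧ offB ⟨12, 1, 1⟩ = true ∧ offB ⟨11, 3, 0⟩ = false ∧ offB ⟨11, 2, 1⟩ = true := by decide
example : offCount ![⟨12, 1, 1⟩, ⟨13, 1, 0⟩, ⟨13, -1, 0⟩, ⟨13, 0, 1⟩] = 1 := by decide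
example : cap 0 = 6 ∧ cap 1 = 7 ∧ cap 2 = 10 ∧ cap 3 = 14 ∧ cap 4 = 21 := by decide

end Summit.HodgeConjecture.HodgeConjecture.Cruxes.BlochSeedDiscOne.CoverCount
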